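import Summits.QuantumFields.BalabanUV.Beta.GAN24.TorusPeriodise

/-!
# `BalabanUV.Beta.FP.PeriodisationBound` — road «FP» for binder row D1, row **IR-5′** (b) «DE-PERIODISATION»: A TORUS-UNIFORM BOUND ON ALL PERIODISATIONS OF A SUMMABLE
# LATTICE KERNEL BOUNDS THE KERNEL ITSELF ([folklore] — the generic lemma; the road instances (an2's fm∕ff legs of `KInv N`, periodised to b05's torus objects by
# `FP/CompositeMinimiserJunction` ∕ `FP/CompositeCovarianceJunction`) are separate files)

HONEST DEPENDENCY (page 1, mandatory): continuum YM on T⁴ ⇐ BetaPertH ∧ nine spine estimates (0/9 proved); BetaPertH ⇐ (D1) ∧ (D4) ∧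
CAP+tail; G-an2-4 gates asym, D1 and NE2/3/4.  HONEST FRAMING (cell contract, verbatim): «discharging `BetaPertH` makes Bałaban's UV
stability UNCONDITIONAL — a real constructive-QFT result; it is NOT the continuum limit and NOT the Clay problem.»  THIS MODULE is elementary [folklore] analysis
of absolutely summable families on `ℤ^D` (Mathlib's `Summable` API: `Summable.comp_injective`, `Summable.sum_add_tsum_compl`, `Summable.tsum_le_tsum_of_inj`,
`tendsto_tsum_compl_atTop_zero`; gan24-p2's `TorusPeriodise.pshift_zero`∕`pshift_injective`); it defines nothing, asserts nothing about Bałaban's objects, cites nothing, mints no `Prop` fact, 0 sorry.  NOT IR-5′'s letters, NOT D1;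
0∕4 row-D1 binders; NOT BetaPertH, NOT continuum, NOT Clay.

ABSOLUTE RULE (cell charter, verbatim): «No internally-minted statement may enter as a cited fact. Every hypothesis is either kernel-proved in this
package or a verbatim quotation of a PUBLISHED theorem with page reference. The manuscript(s) under audit are NOT citable for their own disputed
steps — they are the thing under adjudication; programme-internal (2001/route/tribunal) claims are never citable.»

WHY (the located gap this serves).  `g15/IR5P-UNITS.md` §6 (b) recorded the de-periodisation of the fm∕ff dictionaries as waiting on «`ℤ^D`-side objects for the VECTOR `H_k`∕`𝒞`,
which the tree has only in the scalar case».  For BOUNDS no such object is needed: an2's kernels `wH`, `Gam` of `KInv N` ARE the `ℤ^D`-side objects; their `M`-periodisations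
are b05's torus kernels (`tsum_wH_pshift_eq_Hk`, `tsum_Gam_pshift_eq_Cov`), whose decay the tree certifies UNIFORMLY in the torus (`B5Hk163Torus.norm_HkOp_le`, …); and a
bound holding for all large tori passes to the kernel on `ℤ^D` by the lemma below (the nonzero period shifts leave every finite set, and the tail of a summable family is small).

CONTENT ([folklore]; `pshift P t = (P_ν t_ν)_ν` is `GAN24/TorusPeriodise.pshift`):
* §1 `exists_le_abs_pshift` (a nonzero period shift has a coordinate of modulus `≥ P_ν`), `add_pshift_not_mem` (for `P_ν ≥ R` beyond the radius of a finite set around `x`,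
  no `x + pshift P t`, `t ≠ 0`, lies in it); `pshift_zero`∕`pshift_injective` are `GAN24/TorusPeriodise`'s.
* §2 **`abs_tsum_pshift_sub_le`** — `Summable w` ⟹ `|Σ'_t w (x + pshift P t) − w x| ≤ Σ'_{z ∉ F} |w z|` for every finite `F` avoided by the nonzero shifts.
* §3 **`abs_le_of_periodisations`** — `Summable w`; period vectors `P k` with `min_ν P k ν → ∞`; eventually `|Σ'_t w (x + pshift (P k) t)| ≤ B` ⟹ `|w x| ≤ B`.
Provenance: D1 formalisation swarm LEAF PROVER 05, unit `b2b-balaban-beta-d1-formalise-leaf-05` gen 16, 2026-08-21, road FP row IR-5′ (b) (owner words journal 2026-08-21T06:06:17Z (2)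
«the de-periodised fm dictionary (b) after»); «not in print; our bookkeeping»; no existing file touched.
-/

noncomputable section

namespace Summit.QuantumFields.BalabanUV.Beta.FP.PeriodisationBound

open Finset Filter Topology
open scoped BigOperators
open Literature.MathematicalPhysics.QuantumFieldTheory.Balaban1983to89.Beta
open AffineAveraging (Site)
open Summit.QuantumFields.BalabanUV.Beta.GAN24.TorusPeriodise (pshift pshift_zero pshift_injective)

variable {D : ℕ}

/-! ## §1 Period shifts -/

/-- [folklore] a NONZERO period shift has a coordinate of modulus at least the period: `t ≠ 0 → ∃ ν, P_ν ≤ |(pshift P t)_ν|`. -/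
theorem exists_le_abs_pshift (P : Fin D → ℕ) {t : Site D} (ht : t ≠ 0) : ∃ ν, ((P ν : ℕ) : ℤ) ≤ |pshift P t ν| := by
  obtain ⟨ν, hν⟩ : ∃ ν, t ν ≠ 0 := by
    by_contra h
    push Not at h
    exact ht (funext h)
  refine ⟨ν, ?_⟩
  simp only [pshift, abs_mul]
  have h1 : (1 : ℤ) ≤ |t ν| := Int.one_le_abs hν
  have h2 : |((P ν : ℕ) : ℤ)| = ((P ν : ℕ) : ℤ) := abs_of_nonneg (by positivity)
  calc ((P ν : ℕ) : ℤ) = |((P ν : ℕ) : ℤ)| * 1 := by rw [h2, mul_one]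
    _ ≤ |((P ν : ℕ) : ℤ)| * |t ν| := mul_le_mul_of_nonneg_left h1 (abs_nonneg _)

/-- [folklore] if every period exceeds the radius of a finite set `F` around `x` (`∀ z ∈ F, ∀ ν, |z_ν − x_ν| < R ≤ P_ν`), then NO nonzero shift `x + pshift P t` lies in `F`. -/
theorem add_pshift_not_mem {P : Fin D → ℕ} {R : ℕ} (hPR : ∀ ν, R ≤ P ν) (x : Site D) (F : Finset (Site D))
    (hF : ∀ z ∈ F, ∀ ν, |z ν - x ν| < R) {t : Site D} (ht : t ≠ 0) : x + pshift P t ∉ F := by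
  intro hmem
  obtain ⟨ν, hν⟩ := exists_le_abs_pshift P ht
  have h := hF _ hmem ν
  simp only [Pi.add_apply, add_sub_cancel_left] at h
  have hR : ((P ν : ℕ) : ℤ) < R := lt_of_le_of_lt hν h
  have := hPR ν
  omega

/-! ## §2 The periodisation minus its centre term is a tail of `|w|` -/

/-- **THE PERIODISATION MINUS THE CENTRE TERM IS BOUNDED BY A TAIL** [folklore]: `w` summable on `ℤ^D`, all periods `≥ 1`, and a finite `F` containing none of the
points `x + pshift P t`, `t ≠ 0` ⟹ `|Σ'_t w (x + pshift P t) − w x| ≤ Σ'_{z ∉ F} |w z|`. -/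
theorem abs_tsum_pshift_sub_le {w : Site D → ℝ} (hw : Summable w) (x : Site D) {P : Fin D → ℕ} (hP : ∀ ν, 1 ≤ P ν)
    (F : Finset (Site D)) (hF : ∀ t : Site D, t ≠ 0 → x + pshift P t ∉ F) :
    |∑' t, w (x + pshift P t) - w x| ≤ ∑' z : {z // z ∉ F}, |w z| := by
  classical
  haveI : ∀ ν, NeZero (P ν) := fun ν => ⟨Nat.one_le_iff_ne_zero.mp (hP ν)⟩
  have hinj : Function.Injective (fun t : Site D => x + pshift P t) :=
    fun t s h => pshift_injective P (add_left_cancel h)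
  have hs : Summable (fun t : Site D => w (x + pshift P t)) := hw.comp_injective hinj
  -- split off the centre term `t = 0`
  have hsplit := hs.sum_add_tsum_compl (s := ({0} : Finset (Site D)))
  rw [Finset.sum_singleton, pshift_zero, add_zero] at hsplit
  have hrest : ∑' t, w (x + pshift P t) - w x = ∑' t : ↑((({0} : Finset (Site D)) : Set (Site D))ᶜ), w (x + pshift P t) := by
    rw [← hsplit, add_sub_cancel_left]
  rw [hrest]
  -- compare the off-centre sum with the tail through the injection `t ↦ x + pshift P t`
  have hne : ∀ t : ↑((({0} : Finset (Site D)) : Set (Site D))ᶜ), (t : Site D) ≠ 0 := fun t => by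
    have h := t.2
    simpa using h
  let e : ↑((({0} : Finset (Site D)) : Set (Site D))ᶜ) → {z // z ∉ F} := fun t => ⟨x + pshift P t, hF t (hne t)⟩
  have he : Function.Injective e := by
    intro t s h
    have h' : x + pshift P (t : Site D) = x + pshift P (s : Site D) := congrArg Subtype.val h
    exact Subtype.ext (hinj h')
  have hf : Summable (fun t : ↑((({0} : Finset (Site D)) : Set (Site D))ᶜ) => |w (x + pshift P t)|) := (hs.subtype _).abs
  have hg : Summable (fun z : {z // z ∉ F} => |w z|) := (hw.subtype _).abs
  have hle : ∑' t : ↑((({0} : Finset (Site D)) : Set (Site D))ᶜ), |w (x + pshift P t)| ≤ ∑' z : {z // z ∉ F}, |w z| :=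
    Summable.tsum_le_tsum_of_inj e he (fun _ _ => abs_nonneg _) (fun _ => le_rfl) hf hg
  refine le_trans ?_ hle
  have hn : Summable (fun t : ↑((({0} : Finset (Site D)) : Set (Site D))ᶜ) => ‖w (x + pshift P t)‖) := by
    simpa only [Real.norm_eq_abs] using hf
  have h := norm_tsum_le_tsum_norm hn
  simpa only [Real.norm_eq_abs] using h

/-! ## §3 De-periodisation of a bound -/

/-- **A BOUND ON ALL LARGE PERIODISATIONS BOUNDS THE KERNEL** [folklore]: `w` summable on `ℤ^D`; period vectors `P k` (`k ∈ ℕ`), all `≥ 1`, growing in every direction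
(`∀ R, ∀ᶠ k, ∀ ν, R ≤ P k ν`); if eventually `|Σ'_t w (x + pshift (P k) t)| ≤ B`, then `|w x| ≤ B`.  (The nonzero shifts leave every finite set around `x`; the tail of
`|w|` outside a large finite set is small — `tendsto_tsum_compl_atTop_zero`.) -/
theorem abs_le_of_periodisations {w : Site D → ℝ} (hw : Summable w) (x : Site D) {P : ℕ → Fin D → ℕ} (hP1 : ∀ k ν, 1 ≤ P k ν)
    (hP : ∀ R : ℕ, ∀ᶠ k in atTop, ∀ ν, R ≤ P k ν) {B : ℝ}
    (hB : ∀ᶠ k in atTop, |∑' t, w (x + pshift (P k) t)| ≤ B) : |w x| ≤ B := by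
  classical
  refine le_of_forall_pos_lt_add fun ε hε => ?_
  -- a finite set beyond which the tail of `|w|` is `< ε`
  have htail := tendsto_tsum_compl_atTop_zero (fun z : Site D => |w z|)
  have hev : ∀ᶠ s : Finset (Site D) in atTop, ∑' z : {z // z ∉ s}, |w z| < ε := by
    have h := (htail.eventually (gt_mem_nhds hε))
    exact h
  obtain ⟨F, hFε⟩ : ∃ F : Finset (Site D), ∑' z : {z // z ∉ F}, |w z| < ε := hev.exists
  -- a radius `R` of `F` around `x`
  obtain ⟨R, hR⟩ : ∃ R : ℕ, ∀ z ∈ F, ∀ ν, |z ν - x ν| < R := by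
    refine ⟨F.sup (fun z => Finset.univ.sup fun ν => (z ν - x ν).natAbs) + 1, fun z hz ν => ?_⟩
    have h1 : (z ν - x ν).natAbs ≤ Finset.univ.sup fun ν => (z ν - x ν).natAbs := Finset.le_sup (f := fun ν => (z ν - x ν).natAbs) (Finset.mem_univ ν)
    have h2 : (Finset.univ.sup fun ν => (z ν - x ν).natAbs) ≤ F.sup (fun z => Finset.univ.sup fun ν => (z ν - x ν).natAbs) :=
      Finset.le_sup (f := fun z => Finset.univ.sup fun ν => (z ν - x ν).natAbs) hz
    have h3 : |z ν - x ν| = ((z ν - x ν).natAbs : ℤ) := (Int.natCast_natAbs _).symm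
    rw [h3]
    push_cast
    omega
  -- a large `k`: all periods `≥ R` and the periodisation bound in force
  obtain ⟨k, hkR, hkB⟩ := ((hP R).and hB).exists
  have hnot : ∀ t : Site D, t ≠ 0 → x + pshift (P k) t ∉ F := fun t ht => add_pshift_not_mem hkR x F hR ht
  have hdiff := abs_tsum_pshift_sub_le hw x (hP1 k) F hnot
  have h1 : |w x| ≤ |∑' t, w (x + pshift (P k) t)| + |∑' t, w (x + pshift (P k) t) - w x| := by
    have := abs_sub_abs_le_abs_sub (∑' t, w (x + pshift (P k) t)) (w x)
    have h' : |w x| - |∑' t, w (x + pshift (P k) t)| ≤ |∑' t, w (x + pshift (P k) t) - w x| := by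
      rw [abs_sub_comm]; linarith [abs_sub_abs_le_abs_sub (w x) (∑' t, w (x + pshift (P k) t))]
    linarith
  linarith

end Summit.QuantumFields.BalabanUV.Beta.FP.PeriodisationBound

end
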